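import Summits.QuantumFields.YangMills.Theorems.BalabanUVNodesN15KingModelGraphTreeDecayLetters
import Summits.QuantumFields.YangMills.Theorems.BalabanUVNodesN15KingModelGraphPowerCountingKingR

/-!
# BalabanUVNodes ∕ N15 — THE KING-MODEL RUNG (PART Α-k): THE SIZE OF A GENERAL GRAPH WITH «A SMALL PART OF EACH PROPAGATOR» EXTRACTED — part Γ-h's
# `king_graph_size_uniform_zeroField_R` (the size half of (3.56), UV-finite uniformly in the number of scales) TIMES the weight bound `Θ₀` of the placement-wise
# decay weights: the shape of Theorem 3.5 (i) (3.38) `|E^{(θ)}(H)| ≤ C…exp[−δ dist({y_i},{z_j})]` once `Θ₀ = exp[−δ·treeLength]` (part Α-b)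
# (Track A, DAG node N15 = NE2; FAN-OUT v1.1 §N15 s3 «KING-MODEL RUNG … NE2's analogue DECIDED in the model»)

HONEST FRAMING.  Count-neutral (cell `pub-ymgap`, seat `pub-ymgap-dag-n15-e` g29; `--supports stmt-QuantumFields-27366 --as helper` = K3⁸
`SpineGivenEndpointR13SepCoPHV`).  TEMPLATE LITERATURE: C. King, *The U(1) Higgs model. I. The continuum limit*, Commun. Math. Phys. **102** (1986) 649–677
[King1986], Theorem 3.5 (i) (3.38) p. 660 and the size half of the proof of Proposition 3.6 p. 664, for KING's OWN `A = 0` MODEL (one spacing: the `k`-run's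
graph `E^{(k)}(H)` on `T_η = Tor (fine (L^k) M)`); Prop. 3.7 BY NAME (part Ρ `prop37PrintedAt_king_zeroField`).  NOT Bałaban's `G(U)`; NOT a node discharge;
nothing continuum ∕ ℝ⁴ ∕ OS ∕ mass-gap ∕ Clay.  0 `sorry`; standard axioms.  Text layer of pp. 660–664 (`paper:king1986-cmp102-king-u1-higgs-i` p0012–p0016)
re-read by this seat 2026-08-29.

THE PRINT.  p. 660 [PDF 12], Theorem 3.5 (i) (3.38): *«|E^{(θ)}(H, A^{(θ)}; {y_i}, {z_j})| ≤ C(L^kε)^{…}(p(L^kε))^{n₁} exp[−δ dist({y_i}, {z_j})], where θ is k or k + n»*;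
p. 664 [PDF 16]: *«We get an upper bound for this expression by replacing every propagator by the bounds given in Proposition 3.7 and Theorem 3.3 … By extracting a
small part of each propagator, we get the exponential decay …»*.

READING (declared; ours).  Part Γ-h's size theorem bounds `|E^{(k)}(H)|` by `Γ·C₁^m·C₂^{nn}·(Σ_π degConst)·Π_{υ≠υ₀} q_υ` for any numbered graph with King's full
`A = 0` propagators on its lines, certificates with positive partial degrees, sups `q_υ` and one root-placed `L¹` factor.  Here every line additionally gives
away `exp[−δ|x − y|]` (`0 ≤ δ ≤ δ₀∕2`, the strip lemma of part Α-c on the COARSE slices — no pairing, no `e^{δ₀∕2}`), the one-vertex factors are bounded by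
stripped majorants `p_υ` against nonnegative weights `ϑ_υ`, and the weights' product is `≤ Θ₀` at every placement: then `|E^{(k)}(H)| ≤ Θ₀·Γ·C₁^m·C₂^{nn}·(…)·Π q`
with `C₂ = c368 d (δ₀∕2)`.  With part Α-b's `Θ₀ = exp[−δ·treeLength{y_υ}]` for a connected graph this is (3.38)'s tree decay (corollary kept downstream).

WHAT THIS FILE PROVES (namespace `Summit.QuantumFields.YangMills.BalabanUVNodes.N15KingModelRung.Curved`).
* §1 ★ `abs_sliceLine_le_profileAt` (Prop. 3.7 (3.63) clause 1 IS part Γ-d's profile at `(C, δ₀)`), ★ `abs_sliceLine_le_profileAt_strip` (… `≤ profileAt_{C,δ₀∕2}·e^{−δ|x−y|}`).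
* §2 ★★★ **`king_graph_size_decay_R`** — THE SIZE OF A GENERAL GRAPH WITH THE DECAY EXTRACTED, BY NAME AT `A = 0`: one `(C₁, C₂, δ₁)` such that for every `k ≥ 1`,
  cube `2L^{e_M}`, mass `0 < m² ≤ m₀²`, numbered graph, kinds, one-vertex data `|u_υ| ≤ p_υ·ϑ_υ` (`p_υ ≤ q_υ` off the root, `Σ η^{d+1}p_{υ₀} ≤ Γ`), rate `0 ≤ δ ≤ δ₁`,
  weight bound `Π_ℓ e^{−δ|x_ℓ − y_ℓ|}·Π_υ ϑ_υ ≤ Θ₀` at every placement, and certificates with positive partial degrees along every ordering: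
  `|E^{(k)}(H)| ≤ Θ₀·Γ·C₁^m·C₂^{nn}·(Σ_π degConst L (orderList …))·Π_{υ≠υ₀} q_υ`.

HONEST SCOPE.  (a) King's `A = 0` model, one spacing; positivity of the degrees is a HYPOTHESIS (parts Γ-l∕Δ-b discharge it from (3.77) ∕ p. 664); the weights'
bound `Θ₀` is abstract here (part Α-b supplies `exp[−δ·treeLength]`).  (b) (3.38) proper concerns the graphs of Theorem 3.5 with fields and sources; those enter as
abstract one-vertex factors.  Locators: [King1986] Thm 3.5 (3.38) p.660, Prop. 3.6 p.662, Prop. 3.7 (3.63) p.663, p.664, (3.58)–(3.59) p.663.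
-/

noncomputable section

namespace Summit.QuantumFields.YangMills.BalabanUVNodes.N15KingModelRung.Curved

open scoped BigOperators
open Finset
open Literature.MathematicalPhysics.QuantumFieldTheory.Balaban1983to89.B5Prop11Plancherel (Tor fine)
open Literature.MathematicalPhysics.QuantumFieldTheory.King1986.Torus (tdistT tdistT_nonneg)
open Literature.MathematicalPhysics.QuantumFieldTheory.King1986.SlicePropagator (SliceKernels Prop37PrintedAt)
open Literature.MathematicalPhysics.QuantumFieldTheory.King1986.ContinuumLimit (eps)
open Summit.QuantumFields.YangMills.BalabanUVNodes.N15KingModelRung.Graph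

variable {d : ℕ} (L : ℕ) [NeZero L]

/-! ## §1 The coarse slices against part Γ-d's profile, plain and stripped -/

section Letters

/-- ★ **PROPOSITION 3.7 (3.63), VALUE CLAUSE, IS PART Γ-d's PROFILE**: `|sliceLine D c κ x y| ≤ profileAt_{C,δ₀}(c, lineExp κ)(x, y)` for the `k`-run's datum and every
slice `c + 1 ≤ k`. [cite: King1986, Prop. 3.7 (3.63) p.663] -/
theorem abs_sliceLine_le_profileAt {a msq : ℝ} {k eM : ℕ} (hk : 1 ≤ k) (M : Fin (d + 1) → ℕ) [∀ μ, NeZero (M μ)]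
    (hM : ∀ μ, M μ = 2 * L ^ eM) {α C δ₀ : ℝ} (h37 : Prop37PrintedAt α (kingSliceKernels L k eM M hM hk a msq) C δ₀)
    {c : ℕ} (hc : c + 1 ≤ k) (κ : Option (Fin (d + 1))) (x y : Tor (fine (L ^ k) M)) :
    |sliceLine (kingSliceKernels L k eM M hM hk a msq) c κ x y| ≤ profileAt L k M C δ₀ c (lineExp (d + 1) κ) x y := by
  obtain ⟨h1, -, -⟩ := h37 c hc
  rcases κ with _ | μ
  · exact (h1 x y).1
  · exact (h1 x y).2 μ

/-- ★ **… STRIPPED**: `|sliceLine D c κ x y| ≤ profileAt_{C,δ₀∕2}(c, lineExp κ)(x, y)·e^{−δ|x − y|}` for `0 ≤ δ ≤ δ₀∕2` (part Α-c `profileAt_le_strip`). [cite: King1986,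
Prop. 3.7 (3.63) p.663, p.664 («extracting a small part of each propagator»)] -/
theorem abs_sliceLine_le_profileAt_strip (hL : 1 ≤ L) {a msq : ℝ} {k eM : ℕ} (hk : 1 ≤ k) (M : Fin (d + 1) → ℕ) [∀ μ, NeZero (M μ)]
    (hM : ∀ μ, M μ = 2 * L ^ eM) {α C δ₀ δ : ℝ} (hC : 0 ≤ C) (hδ₀ : 0 ≤ δ₀) (hδ2 : δ ≤ δ₀ / 2)
    (h37 : Prop37PrintedAt α (kingSliceKernels L k eM M hM hk a msq) C δ₀)
    {c : ℕ} (hc : c + 1 ≤ k) (κ : Option (Fin (d + 1))) (x y : Tor (fine (L ^ k) M)) :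
    |sliceLine (kingSliceKernels L k eM M hM hk a msq) c κ x y|
      ≤ profileAt L k M C (δ₀ / 2) c (lineExp (d + 1) κ) x y * Real.exp (-(δ * (tdistT (fine (L ^ k) M) x y / (L : ℝ) ^ k))) :=
  (abs_sliceLine_le_profileAt L hk M hM h37 hc κ x y).trans (profileAt_le_strip L hL M hC hδ₀ hδ2 hc _ x y)

end Letters

/-! ## §2 The size of a general graph with the decay extracted -/

section Size

/-- ★★★ **THE SIZE OF A GENERAL GRAPH WITH KING's FULL `A = 0` PROPAGATORS, WITH «A SMALL PART OF EACH PROPAGATOR» EXTRACTED, BY NAME AT `A = 0`** (part Γ-h's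
`king_graph_size_uniform_zeroField_R` × `Θ₀`).  For odd `L ≥ 3`, `a > 0`, `m₀² ≥ 0` there are `C₁, C₂, δ₁ > 0` such that for every `k ≥ 1`, cube `M = 2L^{e_M}`, mass
`0 < m² ≤ m₀²`, every numbered graph (vertices `0, …, nn`, lines `src`, `tgt`, kinds `κ`; the line `ℓ` carries `G^η_k` or `∂^η_μG^η_k`), one-vertex factors
`|u_υ(x)| ≤ p_υ(x)·ϑ_υ(x)` with nonnegative stripped majorants (`p_υ ≤ q_υ` for `υ ≠ υ₀`, `Σ_x η^{d+1}p_{υ₀} ≤ Γ`) and nonnegative weights, a rate `0 ≤ δ ≤ δ₁`, a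
weight bound `Π_ℓ exp[−δ|x_ℓ − y_ℓ|]·Π_υ ϑ_υ ≤ Θ₀` at EVERY placement, and certificates whose order lists have positive partial degrees along every ordering:
`|E^{(k)}(H)| ≤ Θ₀·Γ·C₁^m·C₂^{nn}·(Σ_π degConst L (orderList …))·Π_{υ≠υ₀} q_υ` — (2.17) multiplied out, part Α-a `abs_graphValLS_le_of_weight` on every `H(j)` with
the stripped profiles of §1, part Γ-h `sum_graphValLS_profileAt_le_R` at `(C, δ₀∕2)`. [cite: King1986, Thm 3.5 (3.38) p.660, p.664 («replacing every propagator
by the bounds … extracting a small part of each propagator»), (3.58)–(3.59) p.663, Prop. 3.7 (3.63) p.663] -/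
theorem king_graph_size_decay_R (hLodd : Odd L) (hL : 2 ≤ L) {a : ℝ} (ha : 0 < a) {m0sq : ℝ} (hm0 : 0 ≤ m0sq) :
    ∃ C₁ C₂ δ₁ : ℝ, 0 < C₁ ∧ 0 < C₂ ∧ 0 < δ₁ ∧ ∀ (k eM : ℕ) (hk : 1 ≤ k) (M : Fin (d + 1) → ℕ) [∀ μ, NeZero (M μ)] (hM : ∀ μ, M μ = 2 * L ^ eM)
      (msq : ℝ), 0 < msq → msq ≤ m0sq →
      ∀ (nn m : ℕ) (src tgt : Fin m → Fin (nn + 1)) (κ : Fin m → Option (Fin (d + 1)))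
        (Υ : Type) [Fintype Υ] [DecidableEq Υ] (vtx : Υ → Fin (nn + 1)) (u ϑ p : Υ → Tor (fine (L ^ k) M) → ℝ) (q : Υ → ℝ) (υ₀ : Υ) (Γ δ Θ₀ : ℝ),
        vtx υ₀ = 0 → (∀ υ x, 0 ≤ ϑ υ x) → (∀ υ x, 0 ≤ p υ x) → (∀ υ x, |u υ x| ≤ p υ x * ϑ υ x) →
        (∀ υ, υ ≠ υ₀ → ∀ x, p υ x ≤ q υ) → (∑ x, (((L : ℝ) ^ k)⁻¹) ^ (d + 1) * p υ₀ x ≤ Γ) → 0 ≤ δ → δ ≤ δ₁ →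
        (∀ σ : Fin (nn + 1) → Tor (fine (L ^ k) M),
          (∏ ℓ, Real.exp (-(δ * (tdistT (fine (L ^ k) M) (σ (src ℓ)) (σ (tgt ℓ)) / (L : ℝ) ^ k)))) * ∏ υ, ϑ υ (σ (vtx υ)) ≤ Θ₀) →
        ∀ cert : Equiv.Perm (Fin m) → ForestCertR nn src tgt,
          (∀ π, PosDegrees (orderList ((d + 1 : ℕ) : ℝ) (fun ℓ => lineExp (d + 1) (κ ℓ)) π (cert π).F)) →
          |graphValLS ((((L : ℝ) ^ k)⁻¹) ^ (d + 1)) src tgt (fun ℓ => kingGLine L M a msq k (κ ℓ)) vtx u|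
            ≤ Θ₀ * (Γ * (C₁ ^ m * C₂ ^ nn
                * (∑ π : Equiv.Perm (Fin m), degConst L (orderList ((d + 1 : ℕ) : ℝ) (fun ℓ => lineExp (d + 1) (κ ℓ)) π (cert π).F))
                * ∏ υ ∈ univ.erase υ₀, q υ)) := by
  obtain ⟨C, δ₀, hC, hδ₀, H⟩ := prop37PrintedAt_king_zeroField (d := d) L hLodd hL ha hm0 (α := 1 / 2) (by norm_num) (by norm_num)
  have hδh : 0 < δ₀ / 2 := by linarith
  refine ⟨C, c368 d (δ₀ / 2), δ₀ / 2, hC, c368_pos d hδh, hδh,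
    fun k eM hk M _ hM msq hm hcap nn m src tgt κ Υ _ _ vtx u ϑ p q υ₀ Γ δ Θ₀ hυ₀ hϑ hp0 hu hpq hΓ hδ hδ1 hΘ cert hpos => ?_⟩
  have h37 := H k eM hk M hM msq hm hcap
  have hL1 : 1 ≤ L := by omega
  have hw0 : (0 : ℝ) ≤ (((L : ℝ) ^ k)⁻¹) ^ (d + 1) := by positivity
  haveI : Nonempty (Tor (fine (L ^ k) M)) := ⟨fun _ => 0⟩
  -- Θ₀ is nonnegative (the weights are)
  have hΘ0 : 0 ≤ Θ₀ := le_trans (mul_nonneg (prod_nonneg fun ℓ _ => Real.exp_nonneg _) (prod_nonneg fun υ _ => hϑ _ _)) (hΘ fun _ => 0)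
  -- (2.17) multiplied out; each `H(j)` with the decay extracted
  rw [graphValLS_kingGLine_eq_sum L hL ha hk M hM hm _ src tgt κ vtx u]
  refine (Finset.abs_sum_le_sum_abs _ _).trans ?_
  have hterm : ∀ j : Fin m → Fin k,
      |graphValLS ((((L : ℝ) ^ k)⁻¹) ^ (d + 1)) src tgt
          (fun ℓ (x y : Tor (fine (L ^ k) M)) => sliceLine (kingSliceKernels L k eM M hM hk a msq) (j ℓ) (κ ℓ) x y) vtx u|
        ≤ Θ₀ * graphValLS ((((L : ℝ) ^ k)⁻¹) ^ (d + 1)) src tgt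
          (fun ℓ (x y : Tor (fine (L ^ k) M)) => profileAt L k M C (δ₀ / 2) (j ℓ) (lineExp (d + 1) (κ ℓ)) x y) vtx p := by
    intro j
    have h := abs_graphValLS_le_of_weight ((((L : ℝ) ^ k)⁻¹) ^ (d + 1)) src tgt vtx
      (fun ℓ (x y : Tor (fine (L ^ k) M)) => sliceLine (kingSliceKernels L k eM M hM hk a msq) (j ℓ) (κ ℓ) x y)
      (fun ℓ (x y : Tor (fine (L ^ k) M)) => profileAt L k M C (δ₀ / 2) (j ℓ) (lineExp (d + 1) (κ ℓ)) x y)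
      (fun _ (x y : Tor (fine (L ^ k) M)) => Real.exp (-(δ * (tdistT (fine (L ^ k) M) x y / (L : ℝ) ^ k))))
      u p ϑ (fun ℓ x y => profileAt_nonneg L M hC.le _ _ _ x y) (fun _ _ _ => Real.exp_nonneg _) hp0 hϑ
      (fun ℓ x y => abs_sliceLine_le_profileAt_strip L hL1 hk M hM hC.le hδ₀.le hδ1 h37 (by have := (j ℓ).isLt; omega) (κ ℓ) x y)
      hu hΘ
    rw [abs_of_nonneg hw0] at h
    exact h
  refine (sum_le_sum fun j _ => hterm j).trans ?_
  rw [← mul_sum]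
  refine mul_le_mul_of_nonneg_left ?_ hΘ0
  exact sum_graphValLS_profileAt_le_R L hL hk M hC.le hδh le_rfl le_rfl vtx (fun ℓ => lineExp (d + 1) (κ ℓ)) p hp0 υ₀ hυ₀ hΓ q hpq cert hpos

end Size

end Summit.QuantumFields.YangMills.BalabanUVNodes.N15KingModelRung.Curved

end
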